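/-
Copyright (c) 2026 the pub-hodgecm-mathlib formalisation cell (harness21).  Prover seat hodgecm-mathlib-A-p16 (g32): road «S3-ram» (LEAD F0P3a-plan (g13); owner∕table
F0P3a-p06 (g15)), the (a2) JUNCTION (J★) of F0P3a-p01 (g17) — organ «(J★) HEAD modulo the CONFIGURATION COUNTS», FILE 4: the κ-signed POOLING over the four literals in
the two isoceles configurations, in the S45 token currency (pure algebra over `ℚ`); 2026-09-02.
-/
import Literature.NumberTheory.Rogawski1990.DepthZeroKappaTransferTypeOneRamifiedKappaSumIsoceles   -- ★ J8-iso (F0P3a-p01 (g16)): `pooled_coeff_P_eq`, `kappaSum_isoceles_shared_pool`, `_opposite_pool`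
import HarnessLib

/-!
# The ramified type-(1) `κ`-orbital integral: κ-SIGNED POOLING OF THE S45 REGION DATA OVER THE FOUR LITERALS (isoceles configurations) — pure algebra
# (Rogawski 1990 §4.9 Prop. 4.9.1 (a); Kottwitz 1986 §3; Labesse–Langlands 1979 §5)

Topic `NumberTheory/Rogawski1990`; namespace `Literature.NumberTheory.Rogawski1990`.  THEOREMS ONLY (no definition, no instance, no notation, no named fact, no `sorry`); kernel
lane `--supports stmt-HodgeConjecture-24833`; Mathlib (+ ★ J8-iso) only.  Cell `pub/hodgecm-mathlib` (D-0151), crux H413; road «S3-ram» (count-neutral), the (a2) JUNCTION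
(J★) of F0P3a-p01 (g17): organ «(J★) HEAD modulo the CONFIGURATION COUNTS» (A-p16 (g32)), FILE 4.  The iso engine `strataCount_J₀_isoceles` (junction skeleton v11
:1187) gives the five counts of ONE literal as `#R·e₄ + q·PE·S(E) + q·PP·S(P⁺) + q·PM·S(P⁻)`, and S45 (F0P3a-p02 (g17) v4 bc98a4a1, `row_S45_hyperbolic` ∕ `row_S45_bare`)
supplies `#R, PE, PP, PM` as `if`-expressions in three residual TOKENS of the literal — HYPERBOLIC (the root plane of the two non-isolated eigen-directions is residually
isotropic), BIG (the END-vertex form is residually hyperbolic) and LOCK (the root line's value is in the class of `−c₁`).  Over the four literals `b = (b₁, b₂)` these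
tokens are SIGN PATTERNS `(−1)^(linear form in b)·χ = 1` (★ DEAL T `UnitaryLatticeTreeResidualTokens`, F0P3a-p05): THIS FILE does the resulting bookkeeping once,
abstractly over `ℚ` (atoms `e4 E Pp Pm` = the `j`-components of `e₄, S(E), S(P⁺), S(P⁻)`):
* `isoPool_hyp_add_hyp_sub_two_bare` (shared-κ POOL): `T(BIG, L) + T(SMALL, L) − 2·BARE(¬L) = 4q^(s+1)E + (2q^(s+2) − 2q² − 2q)(Pp + Pm) + 4q(Σ_(i<s)qⁱ)e₄` for either lock
  value `L` (★ `pooled_coeff_P_eq`; `N_int = A − 2q^s`);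
* `isoPool_hyp_sub_hyp` (opposite-κ POOL): `T(BIG, L) − T(SMALL, L) = 2q^(s+1)(2E − (Pp + Pm))`;
* `signedSum_isoTokens_shared` (configuration `N₁ = N₂ < N`, isolated `u`, `(j,k) = (0,2)`): hyperbolic ⟺ `(−1)^b₂·H = 1`, big ⟺ `(−1)^b₁·B = 1`, lock ⟺ `(−1)^b₂·Λ = 1`
  ⇒ `Σ_b (−1)^b₂ n_b = H·(POOLED)`;
* `signedSum_isoTokens_opposite` (configuration `N₁ < N₂`, isolated `α`, `(j,k) = (1,2)`): hyperbolic ⟺ `(−1)^b₁·H = 1`, big ⟺ `(−1)^b₂·B = 1`, lock ⟺ `(−1)^b₁·Λ = 1`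
  ⇒ `Σ_b (−1)^b₂ n_b = B·(2q^(s+1)(2E − (Pp + Pm)))`;
* `signedSum_isoTokens_opposite'` (configuration `N₂ < N₁`, isolated `γ`, `(j,k) = (1,0)`): hyperbolic ⟺ `(−1)^(b₁+b₂)·H = 1`, big ⟺ `(−1)^b₂·B = 1`,
  lock ⟺ `(−1)^(b₁+b₂)·Λ = 1` ⇒ the same.
HONEST LABEL: HC_CM is proved only modulo the 2 remaining named inputs (hLiu418 24832, h413 24833) until rung 0 closes; nothing printed is asserted here (bookkeeping over `ℚ`).

## References
* [Rogawski1990] J. D. Rogawski, *Automorphic Representations of Unitary Groups in Three Variables*, Ann. of Math. Stud. 123 (1990), §4.9 Prop. 4.9.1 (a) p. 55.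
* [Kottwitz1986] R. E. Kottwitz, *Base change for unit elements of Hecke algebras*, Compositio Math. 60 (1986), §3.
* [LabesseLanglands1979] J.-P. Labesse, R. P. Langlands, *L-indistinguishability for SL(2)*, Canad. J. Math. 31 (1979), §5 (κ-signs over the four twists).
-/

set_option autoImplicit false

open Finset

namespace Literature.NumberTheory.Rogawski1990

/-- **SHARED-κ POOL in the S45 token currency, LOCKED hyperbolic pair** (bare pair unlocked): big + small − 2·bare = the left side of ★ `kappaSum_isoceles_eq` (`1 ≤ s`).
[cite: Kottwitz1986, §3] [cite: Rogawski1990, §4.9 Prop. 4.9.1 (a) p. 55] -/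
theorem isoPool_shared_lock (q s : ℕ) (hs : 1 ≤ s) (e4 E Pp Pm : ℚ) :
    ((1 + 2 * (q : ℚ) * ∑ i ∈ Finset.range s, (q : ℚ) ^ i) * e4 + (q : ℚ) * (4 * (q : ℚ) ^ s) * E + (q : ℚ) * (((q : ℚ) - 1) * (1 + 2 * (q : ℚ) * ∑ i ∈ Finset.range (s - 1), (q : ℚ) ^ i) + (q : ℚ) ^ s * ((q : ℚ) - 3)) * Pp + (q : ℚ) * ((q : ℚ) ^ s * ((q : ℚ) - 1)) * Pm) + ((1 + 2 * (q : ℚ) * ∑ i ∈ Finset.range s, (q : ℚ) ^ i) * e4 + (q : ℚ) * 0 * E + (q : ℚ) * (((q : ℚ) - 1) * (1 + 2 * (q : ℚ) * ∑ i ∈ Finset.range (s - 1), (q : ℚ) ^ i) + (q : ℚ) ^ s * ((q : ℚ) - 1)) * Pp + (q : ℚ) * ((q : ℚ) ^ s * ((q : ℚ) + 1)) * Pm) - 2 * (e4 + (q : ℚ) * 0 * Pp + (q : ℚ) * ((q : ℚ) + 1) * Pm) = (4 * (q : ℚ) ^ (s + 1) * E + (2 * (q : ℚ) ^ (s + 2)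 - 2 * (q : ℚ) ^ 2 - 2 * q) * (Pp + Pm) + 4 * (q : ℚ) * (∑ i ∈ Finset.range s, (q : ℚ) ^ i) * e4) := by
  have hN : (1 + 2 * (q : ℚ) * ∑ i ∈ Finset.range (s - 1), (q : ℚ) ^ i) = (1 + 2 * (q : ℚ) * ∑ i ∈ Finset.range s, (q : ℚ) ^ i) - 2 * (q : ℚ) ^ s := by
    obtain ⟨t, rfl⟩ : ∃ t, s = t + 1 := ⟨s - 1, by omega⟩
    rw [Nat.add_sub_cancel, Finset.sum_range_succ, pow_succ]
    ring
  have hP := pooled_coeff_P_eq (q : ℚ) s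
  rw [hN]
  linear_combination Pp * hP

/-- **SHARED-κ POOL, UNLOCKED hyperbolic pair** (bare pair locked): the same with `Pp ↔ Pm`. [cite: Kottwitz1986, §3] [cite: Rogawski1990, §4.9 Prop. 4.9.1 (a) p. 55] -/
theorem isoPool_shared_unlock (q s : ℕ) (hs : 1 ≤ s) (e4 E Pp Pm : ℚ) :
    ((1 + 2 * (q : ℚ) * ∑ i ∈ Finset.range s, (q : ℚ) ^ i) * e4 + (q : ℚ) * (4 * (q : ℚ) ^ s) * E + (q : ℚ) * ((q : ℚ) ^ s * ((q : ℚ) - 1)) * Pp + (q : ℚ) * (((q : ℚ) - 1) * (1 + 2 * (q : ℚ) * ∑ i ∈ Finset.range (s - 1), (q : ℚ) ^ i) + (q : ℚ) ^ s * ((q : ℚ) - 3)) * Pm) + ((1 + 2 * (q : ℚ) * ∑ i ∈ Finset.range s, (q : ℚ) ^ i) * e4 + (q : ℚ) * 0 * E + (q : ℚ) * ((q : ℚ) ^ s * ((q : ℚ) + 1)) * Pp + (q : ℚ) * (((q : ℚ) - 1) * (1 + 2 * (q : ℚ) * ∑ i ∈ Finset.range (s - 1), (q : ℚ) ^ i)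 + (q : ℚ) ^ s * ((q : ℚ) - 1)) * Pm) - 2 * (e4 + (q : ℚ) * ((q : ℚ) + 1) * Pp + (q : ℚ) * 0 * Pm) = (4 * (q : ℚ) ^ (s + 1) * E + (2 * (q : ℚ) ^ (s + 2) - 2 * (q : ℚ) ^ 2 - 2 * q) * (Pp + Pm) + 4 * (q : ℚ) * (∑ i ∈ Finset.range s, (q : ℚ) ^ i) * e4) := by
  have hN : (1 + 2 * (q : ℚ) * ∑ i ∈ Finset.range (s - 1), (q : ℚ) ^ i) = (1 + 2 * (q : ℚ) * ∑ i ∈ Finset.range s, (q : ℚ) ^ i) - 2 * (q : ℚ) ^ s := by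
    obtain ⟨t, rfl⟩ : ∃ t, s = t + 1 := ⟨s - 1, by omega⟩
    rw [Nat.add_sub_cancel, Finset.sum_range_succ, pow_succ]
    ring
  have hP := pooled_coeff_P_eq (q : ℚ) s
  rw [hN]
  linear_combination Pm * hP

/-- **OPPOSITE-κ POOL in the S45 token currency**: big − small (common lock, either value) `= 2q^(s+1)(2E − (Pp + Pm))`. [cite: Kottwitz1986, §3]
[cite: Rogawski1990, §4.9 Prop. 4.9.1 (a) p. 55] -/
theorem isoPool_opposite_lock (q s : ℕ) (e4 E Pp Pm : ℚ) :
    ((1 + 2 * (q : ℚ) * ∑ i ∈ Finset.range s, (q : ℚ) ^ i) * e4 + (q : ℚ) * (4 * (q : ℚ) ^ s) * E + (q : ℚ) * (((q : ℚ) - 1) * (1 + 2 * (q : ℚ) * ∑ i ∈ Finset.range (s - 1), (q : ℚ) ^ i) + (q : ℚ) ^ s * ((q : ℚ) - 3)) * Pp + (q : ℚ) * ((q : ℚ) ^ s * ((q : ℚ) - 1)) * Pm) - ((1 + 2 * (q : ℚ) * ∑ i ∈ Finset.range s, (q : ℚ) ^ i) * e4 + (q : ℚ) * 0 * E + (q :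 ℚ) * (((q : ℚ) - 1) * (1 + 2 * (q : ℚ) * ∑ i ∈ Finset.range (s - 1), (q : ℚ) ^ i) + (q : ℚ) ^ s * ((q : ℚ) - 1)) * Pp + (q : ℚ) * ((q : ℚ) ^ s * ((q : ℚ) + 1)) * Pm) = (2 * (q : ℚ) ^ (s + 1) * (2 * E - (Pp + Pm))) := by
  ring

/-- The same, unlocked. [cite: Kottwitz1986, §3] [cite: Rogawski1990, §4.9 Prop. 4.9.1 (a) p. 55] -/
theorem isoPool_opposite_unlock (q s : ℕ) (e4 E Pp Pm : ℚ) :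
    ((1 + 2 * (q : ℚ) * ∑ i ∈ Finset.range s, (q : ℚ) ^ i) * e4 + (q : ℚ) * (4 * (q : ℚ) ^ s) * E + (q : ℚ) * ((q : ℚ) ^ s * ((q : ℚ) - 1)) * Pp + (q : ℚ) * (((q : ℚ) - 1) * (1 + 2 * (q : ℚ) * ∑ i ∈ Finset.range (s - 1), (q : ℚ) ^ i) + (q : ℚ) ^ s * ((q : ℚ) - 3)) * Pm) - ((1 + 2 * (q : ℚ) * ∑ i ∈ Finset.range s, (q : ℚ) ^ i) * e4 + (q : ℚ) * 0 * E + (q : ℚ) * ((q : ℚ) ^ s * ((q : ℚ) + 1)) * Pp + (q : ℚ) * (((q : ℚ) - 1) * (1 + 2 * (q : ℚ) * ∑ i ∈ Finset.range (s - 1), (q : ℚ) ^ i) + (q : ℚ) ^ s * ((q : ℚ) - 1)) * Pm) = (2 * (q : ℚ) ^ (s + 1) * (2 * E - (Pp + Pm))) := by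
  ring

/-- `(−1)^n` for `n : ℕ` is `1` or `−1` in `ℤ`. [folklore] -/
private theorem neg_one_pow_eq_or (n : ℕ) : (-1 : ℤ) ^ n = 1 ∨ (-1 : ℤ) ^ n = -1 := by
  rcases Nat.even_or_odd n with h | h
  · exact Or.inl h.neg_one_pow
  · exact Or.inr h.neg_one_pow

/-- **κ-SIGNED SUM OVER THE FOUR LITERALS, SHARED-κ CONFIGURATION** (`N₁ = N₂ < N`, `u` isolated, `(j,k) = (0,2)`): with hyperbolic ⟺ `(−1)^b₂H = 1`, big ⟺ `(−1)^b₁B = 1`,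
lock ⟺ `(−1)^b₂Λ = 1` (`H B Λ = ±1`), `Σ_b (−1)^b₂·n_b = H · (shared pool)`. [cite: LabesseLanglands1979, §5] [cite: Rogawski1990, §4.9 Prop. 4.9.1 (a) p. 55] -/
theorem signedSum_isoTokens_shared (q s : ℕ) (hs : 1 ≤ s) (H B Λ : ℤ) (hH : H = 1 ∨ H = -1) (hB : B = 1 ∨ B = -1) (hΛ : Λ = 1 ∨ Λ = -1) (e4 E Pp Pm : ℚ)
    (hyp big lock : Fin 2 × Fin 2 → Prop) [DecidablePred hyp] [DecidablePred big] [DecidablePred lock]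
    (hhyp : ∀ b, hyp b ↔ (-1 : ℤ) ^ (b.2 : ℕ) * H = 1) (hbig : ∀ b, big b ↔ (-1 : ℤ) ^ (b.1 : ℕ) * B = 1) (hlock : ∀ b, lock b ↔ (-1 : ℤ) ^ (b.2 : ℕ) * Λ = 1)
    (f : Fin 2 × Fin 2 → ℚ) (hf : ∀ b, f b = if hyp b then ((1 + 2 * (q : ℚ) * ∑ i ∈ Finset.range s, (q : ℚ) ^ i) * e4 + (q : ℚ) * (if big b then 4 * (q : ℚ) ^ s else 0) * E + (q : ℚ) * (if lock b then (if big b then (((q : ℚ) - 1) * (1 + 2 * (q : ℚ) * ∑ i ∈ Finset.range (s - 1), (q : ℚ) ^ i) + (q : ℚ) ^ s * ((q : ℚ) - 3)) else (((q : ℚ) - 1) * (1 + 2 * (q : ℚ) * ∑ i ∈ Finset.range (s - 1), (q : ℚ) ^ i) + (q : ℚ) ^ s * ((q : ℚ) - 1))) else (if big b then ((q : ℚ) ^ s * ((q : ℚ) - 1)) else ((q : ℚ) ^ s * ((q : ℚ) + 1)))) * Pp + (q : ℚ) * (if lock b then (if big b then ((q : ℚ) ^ s * ((q : ℚ) - 1))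 else ((q : ℚ) ^ s * ((q : ℚ) + 1))) else (if big b then (((q : ℚ) - 1) * (1 + 2 * (q : ℚ) * ∑ i ∈ Finset.range (s - 1), (q : ℚ) ^ i) + (q : ℚ) ^ s * ((q : ℚ) - 3)) else (((q : ℚ) - 1) * (1 + 2 * (q : ℚ) * ∑ i ∈ Finset.range (s - 1), (q : ℚ) ^ i) + (q : ℚ) ^ s * ((q : ℚ) - 1)))) * Pm) else (e4 + (q : ℚ) * (if lock b then ((q : ℚ) + 1) else 0) * Pp + (q : ℚ) * (if lock b then 0 else ((q : ℚ) + 1)) * Pm)) :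
    ∑ b : Fin 2 × Fin 2, (-1 : ℚ) ^ (b.2 : ℕ) * f b = (H : ℚ) * (4 * (q : ℚ) ^ (s + 1) * E + (2 * (q : ℚ) ^ (s + 2) - 2 * (q : ℚ) ^ 2 - 2 * q) * (Pp + Pm) + 4 * (q : ℚ) * (∑ i ∈ Finset.range s, (q : ℚ) ^ i) * e4) := by
  have kT := isoPool_shared_lock q s hs e4 E Pp Pm
  have kF := isoPool_shared_unlock q s hs e4 E Pp Pm
  simp only [Fintype.sum_prod_type, Fin.sum_univ_two, Fin.val_zero, Fin.val_one, pow_zero, pow_one, one_mul, neg_mul, hf]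
  simp only [hhyp, hbig, hlock, Fin.val_zero, Fin.val_one, pow_zero, pow_one, one_mul, neg_mul]
  rcases hH with rfl | rfl <;> rcases hB with rfl | rfl <;> rcases hΛ with rfl | rfl <;> norm_num <;>
    first
      | linear_combination kT
      | linear_combination kF
      | linear_combination (-1 : ℚ) * kT
      | linear_combination (-1 : ℚ) * kF

/-- **κ-SIGNED SUM OVER THE FOUR LITERALS, OPPOSITE-κ CONFIGURATION, `α` ISOLATED** (`N₁ < N₂`, `(j,k) = (1,2)`): hyperbolic ⟺ `(−1)^b₁H = 1`, big ⟺ `(−1)^b₂B = 1`,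
lock ⟺ `(−1)^b₁Λ = 1` ⇒ `Σ_b (−1)^b₂·n_b = B · 2q^(s+1)(2E − (Pp + Pm))` (the bare pair cancels, the hyperbolic pair has opposite signs). [cite: LabesseLanglands1979, §5]
[cite: Rogawski1990, §4.9 Prop. 4.9.1 (a) p. 55] -/
theorem signedSum_isoTokens_opposite (q s : ℕ) (H B Λ : ℤ) (hH : H = 1 ∨ H = -1) (hB : B = 1 ∨ B = -1) (hΛ : Λ = 1 ∨ Λ = -1) (e4 E Pp Pm : ℚ)
    (hyp big lock : Fin 2 × Fin 2 → Prop) [DecidablePred hyp] [DecidablePred big] [DecidablePred lock]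
    (hhyp : ∀ b, hyp b ↔ (-1 : ℤ) ^ (b.1 : ℕ) * H = 1) (hbig : ∀ b, big b ↔ (-1 : ℤ) ^ (b.2 : ℕ) * B = 1) (hlock : ∀ b, lock b ↔ (-1 : ℤ) ^ (b.1 : ℕ) * Λ = 1)
    (f : Fin 2 × Fin 2 → ℚ) (hf : ∀ b, f b = if hyp b then ((1 + 2 * (q : ℚ) * ∑ i ∈ Finset.range s, (q : ℚ) ^ i) * e4 + (q : ℚ) * (if big b then 4 * (q : ℚ) ^ s else 0) * E + (q : ℚ) * (if lock b then (if big b then (((q : ℚ) - 1) * (1 + 2 * (q : ℚ) * ∑ i ∈ Finset.range (s - 1), (q : ℚ) ^ i) + (q : ℚ) ^ s * ((q : ℚ) - 3)) else (((q : ℚ) - 1) * (1 + 2 * (q : ℚ) * ∑ i ∈ Finset.range (s - 1), (q : ℚ) ^ i) + (q : ℚ) ^ s * ((q : ℚ) - 1))) else (if big b then ((q : ℚ) ^ s * ((q : ℚ) - 1)) else ((q : ℚ) ^ s * ((q : ℚ) + 1)))) * Pp + (q : ℚ) * (if lock b then (if big b then ((q : ℚ) ^ s * ((q : ℚ) - 1))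 else ((q : ℚ) ^ s * ((q : ℚ) + 1))) else (if big b then (((q : ℚ) - 1) * (1 + 2 * (q : ℚ) * ∑ i ∈ Finset.range (s - 1), (q : ℚ) ^ i) + (q : ℚ) ^ s * ((q : ℚ) - 3)) else (((q : ℚ) - 1) * (1 + 2 * (q : ℚ) * ∑ i ∈ Finset.range (s - 1), (q : ℚ) ^ i) + (q : ℚ) ^ s * ((q : ℚ) - 1)))) * Pm) else (e4 + (q : ℚ) * (if lock b then ((q : ℚ) + 1) else 0) * Pp + (q : ℚ) * (if lock b then 0 else ((q : ℚ) + 1)) * Pm)) :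
    ∑ b : Fin 2 × Fin 2, (-1 : ℚ) ^ (b.2 : ℕ) * f b = (B : ℚ) * (2 * (q : ℚ) ^ (s + 1) * (2 * E - (Pp + Pm))) := by
  simp only [Fintype.sum_prod_type, Fin.sum_univ_two, Fin.val_zero, Fin.val_one, pow_zero, pow_one, one_mul, neg_mul, hf]
  simp only [hhyp, hbig, hlock, Fin.val_zero, Fin.val_one, pow_zero, pow_one, one_mul, neg_mul]
  rcases hH with rfl | rfl <;> rcases hB with rfl | rfl <;> rcases hΛ with rfl | rfl <;> norm_num <;>
    ring

/-- **κ-SIGNED SUM OVER THE FOUR LITERALS, OPPOSITE-κ CONFIGURATION, `γ` ISOLATED** (`N₂ < N₁`, `(j,k) = (1,0)`): hyperbolic ⟺ `(−1)^(b₁+b₂)H = 1`, big ⟺ `(−1)^b₂B = 1`,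
lock ⟺ `(−1)^(b₁+b₂)Λ = 1` ⇒ `Σ_b (−1)^b₂·n_b = B · 2q^(s+1)(2E − (Pp + Pm))`. [cite: LabesseLanglands1979, §5] [cite: Rogawski1990, §4.9 Prop. 4.9.1 (a) p. 55] -/
theorem signedSum_isoTokens_opposite' (q s : ℕ) (H B Λ : ℤ) (hH : H = 1 ∨ H = -1) (hB : B = 1 ∨ B = -1) (hΛ : Λ = 1 ∨ Λ = -1) (e4 E Pp Pm : ℚ)
    (hyp big lock : Fin 2 × Fin 2 → Prop) [DecidablePred hyp] [DecidablePred big] [DecidablePred lock]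
    (hhyp : ∀ b, hyp b ↔ (-1 : ℤ) ^ ((b.1 : ℕ) + (b.2 : ℕ)) * H = 1) (hbig : ∀ b, big b ↔ (-1 : ℤ) ^ (b.2 : ℕ) * B = 1)
    (hlock : ∀ b, lock b ↔ (-1 : ℤ) ^ ((b.1 : ℕ) + (b.2 : ℕ)) * Λ = 1)
    (f : Fin 2 × Fin 2 → ℚ) (hf : ∀ b, f b = if hyp b then ((1 + 2 * (q : ℚ) * ∑ i ∈ Finset.range s, (q : ℚ) ^ i) * e4 + (q : ℚ) * (if big b then 4 * (q : ℚ) ^ s else 0) * E + (q : ℚ) * (if lock b then (if big b then (((q : ℚ) - 1) * (1 + 2 * (q : ℚ) * ∑ i ∈ Finset.range (s - 1), (q : ℚ) ^ i) + (q : ℚ) ^ s * ((q : ℚ) - 3)) else (((q : ℚ) - 1) * (1 + 2 * (q : ℚ) * ∑ i ∈ Finset.range (s - 1), (q : ℚ) ^ i) + (q : ℚ) ^ s * ((q : ℚ) - 1))) else (if big b then ((q : ℚ) ^ s * ((q : ℚ) - 1)) else ((q : ℚ) ^ s * ((q : ℚ) + 1)))) * Pp + (q : ℚ) * (if lock b then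 (if big b then ((q : ℚ) ^ s * ((q : ℚ) - 1)) else ((q : ℚ) ^ s * ((q : ℚ) + 1))) else (if big b then (((q : ℚ) - 1) * (1 + 2 * (q : ℚ) * ∑ i ∈ Finset.range (s - 1), (q : ℚ) ^ i) + (q : ℚ) ^ s * ((q : ℚ) - 3)) else (((q : ℚ) - 1) * (1 + 2 * (q : ℚ) * ∑ i ∈ Finset.range (s - 1), (q : ℚ) ^ i) + (q : ℚ) ^ s * ((q : ℚ) - 1)))) * Pm) else (e4 + (q : ℚ) * (if lock b then ((q : ℚ) + 1) else 0) * Pp + (q : ℚ) * (if lock b then 0 else ((q : ℚ) + 1)) * Pm)) :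
    ∑ b : Fin 2 × Fin 2, (-1 : ℚ) ^ (b.2 : ℕ) * f b = (B : ℚ) * (2 * (q : ℚ) ^ (s + 1) * (2 * E - (Pp + Pm))) := by
  simp only [Fintype.sum_prod_type, Fin.sum_univ_two, Fin.val_zero, Fin.val_one, pow_zero, pow_one, one_mul, neg_mul, hf]
  simp only [hhyp, hbig, hlock, Fin.val_zero, Fin.val_one, pow_zero, pow_one, one_mul, neg_mul, zero_add, add_zero]
  rcases hH with rfl | rfl <;> rcases hB with rfl | rfl <;> rcases hΛ with rfl | rfl <;> norm_num <;>
    ring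

end Literature.NumberTheory.Rogawski1990
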